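import Summits.FinalStateConjecture.FinalStateConjecture.Theorems.PhaseMixingCaptureNearExtremalKappaCaptureCentreFarComplete
import Summits.FinalStateConjecture.FinalStateConjecture.Theorems.PhaseMixingCaptureBulkKerrCaptureC2CaptureAscent
import HarnessLib

/-!
# Crux `PhaseMixingCapture.BulkKerrCaptureC2` (stmt-FinalStateConjecture-14985): the crux holds AT THE
# CENTRE of every data ball — every maximal vacuum Cauchy development of the exact sub-extremal Kerr
# datum is far-complete and converges (in every `Cᵏ`, parameters pinned) to `g_{M,a}`

Support file for the crux `BulkKerrCaptureC2` (sub-extremal Kerr capture in the bulk, import grade,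
convergence order `k = 2`).  Its matrix `CaptureC2At s δ M _ ε η a` (`Negative.BlockForm`) concludes, for
every b-conormal vacuum datum `D` in the `H^s_δ`-ball of radius `ε` about `Kerr.data M a M` and every
MAXIMAL vacuum Cauchy development `𝒟` of `D`: far-origin completeness of `𝓘⁺` in Christodoulou's sojourn
form (`DataEmbedding.HasCompleteFutureNullInfinityFar`), a region converging in `C²` to a sub-extremal
`g_{M',a'}`, and `|M' − M| + |a' − a| ≤ η`.  The centre `D = Kerr.data M a M` lies in every such ball
(distance `0`, b-conormal trivially, vacuum constraints by the tree theorem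
`Kerr.data_isVacuumConstraintSolution_holds`), so the block's conclusion at the exact Kerr datum is a
NECESSARY condition for the crux, recorded conditionally as `Negative.bulkKerrCaptureC2_atKerrData`
("expected-true sanity statement at the centre; no refutation there").

This file PROVES that necessary condition outright, for every `0 < M` and every sub-extremal spin
`|a| < M`, with the final parameters pinned to `(M, a)` and at every convergence order `k`:

* `exists_goodDevelopment_centre` — the existential ("one good development per datum",
  `CaptureAscent.bulkKerrCaptureC2_of_forall_exists`) form of the crux AT THE CENTRE: the Kerr slab
  `KerrSlab.development hM ha` (the half-chart `{t* + (r − M)/4 > 0}` of the ingoing Kerr–Schild star chart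
  `{r > M}`, a vacuum Cauchy development of `Kerr.data M a M`, landed for the sibling crux
  `NearExtremalKappaCapture`) is far-complete (`farComplete_kerrSlab`: conserved Killing energy, two-speed
  bounds and banking of the flat-leaf optics) and converges to `g_{M,a}` in every `Cᵏ` (the time-squashed
  identity chart of the exterior, `convergesToKerr_of_slabEmbedding` at the identity embedding: the metric
  deviation vanishes identically, with all derivatives, on every leaf `{t* = τ}`, `τ > 0`);
* `conclusion_centre` — hence, by ascent along the embedding that maximality provides
  (`VacuumCauchyDevelopment.IsMaximal`; `CaptureAscent.hasCompleteFutureNullInfinityFar_of_embedsInto`,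
  `CaptureAscent.convergesToKerr_of_embedsInto`), EVERY maximal vacuum Cauchy development of the exact datum
  is far-complete and has a region converging in `Cᵏ` to `g_{M,a}`;
* `captureC2At_centre` — the matrix `CaptureC2At` of the crux restricted to its centre datum holds for every
  exponent vector `(s, δ)`, basin `ε` and tolerance `η ≥ 0` (witness `(M', a') = (M, a)`);
* `atKerrData_holds`, `atSchwarzschildData_holds` — the consequents of
  `Negative.bulkKerrCaptureC2_atKerrData` / `Negative.bulkKerrCaptureC2_atSchwarzschildData` WITHOUT their
  hypotheses `h : BulkKerrCaptureC2` and `hvac`: the centre of every ball of the crux is captured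
  unconditionally, so a refutation of the crux must use a datum at POSITIVE distance from `Kerr.data M a M`
  (`dist_pos_of_not_conclusion`).

Nothing here closes the crux (off the centre it is the nonlinear stability of the sub-extremal Kerr family in
the tree's Cauchy consequence form, Hintz arXiv:2606.28253, Thm. 13.1, taken in the tree as the claim
`Literature.Geometry.Lorentzian.hintz_kerr_stability_subextremal_cauchy_allOrders`); no named fact is consumed
(`[Kerr.Facts]`, `[Kerr.SliceFacts]` are the standing, discharged instance hypotheses of `Kerr.data`).

References: Y. Choquet-Bruhat, R. Geroch, CMP 14 (1969), Thm. 3; H. Ringström, *The Cauchy problem in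
General Relativity* (2009), Def. 16.5; D. Christodoulou, CQG 16 (1999) A23, pp. A26–A27; M. Dafermos,
I. Rodnianski, arXiv:0811.0354, §2.6.2, §5.1; M. Dafermos, G. Holzegel, I. Rodnianski, M. Taylor,
arXiv:2104.08222, §1 (consequence form of convergence to Kerr).
-/

-- the doubled `FinalStateConjecture.FinalStateConjecture` path component trips dupNamespace
set_option linter.dupNamespace false

noncomputable section

open Set Filter Function Topology
open scoped Manifold ContDiff Topology ENNReal
open Literature.Geometry.Lorentzian
open Summit.FinalStateConjecture.FinalStateConjecture.Theorems.NearExtremalKappaCapture.UnitTemperatureFrontFace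
  (stub_captureTransferCentreFarComplete convergesToKerr_image_of_lateChart)
open Summit.FinalStateConjecture.FinalStateConjecture.Theorems.NearExtremalKappaCapture.UnitTemperatureFrontFace.CentreFarComplete
  (farComplete_kerrSlab)
open Summit.FinalStateConjecture.FinalStateConjecture.Theorems.NearExtremalKappaCapture.AreaExcessRatchet
  (farComplete_iff_hasCompleteFutureNullInfinityFar)
open Summit.FinalStateConjecture.FinalStateConjecture.Theorems.BulkKerrCaptureC2.Negative (CaptureC2At)
open Summit.FinalStateConjecture.FinalStateConjecture.Theorems.BulkKerrCaptureC2.CaptureAscent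
  (hasCompleteFutureNullInfinityFar_of_embedsInto convergesToKerr_of_embedsInto)

namespace Summit.FinalStateConjecture.FinalStateConjecture.Theorems.BulkKerrCaptureC2.Centre

open NearExtremalKappaCapture.UnitTemperatureFrontFace.KerrSlab

variable {M a : ℝ}

/-! ## §1 The Kerr slab converges to `g_{M,a}` in every development it embeds into -/

section Chart

/-- **An isometric copy of the Kerr slab carries an exactly isometric late chart of the Kerr exterior.**  If
`ψ : KerrSlab.domain a M → 𝓢` (`0 < M`, `|a| < M`) is smooth, an open embedding, and pulls the metric of the
spacetime `𝓢` back to `g_{M,a}`, then `Ψ := ψ ∘ squashChart` (the time squash of the exterior into the slab,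
the identity on `{t* ≥ 0}`) is smooth on the whole Kerr exterior, an open embedding on the late region
`{t* > 0}`, and its `Cᵏ` metric deviation from `g_{M,a}` VANISHES on every leaf `{t* = τ}`, `τ > 0`.
DHRT arXiv:2104.08222, §1 (consequence form); Dafermos–Rodnianski arXiv:0811.0354, §5.1.
-- adapted from `KerrSlab.exterior_chart` (PhaseMixingCaptureNearExtremalKappaCaptureCentreConverges.lean),
-- with the maximality hypothesis replaced by the embedding it was used to produce
[cite: arXiv210408222, §1] -/
theorem chart_of_slabEmbedding (hM : 0 < M) (ha : |a| < M) (k : ℕ) (𝓢 : Spacetime.{0} 4)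
    (ψ : domain a M → 𝓢.carrier) (hψs : ContMDiff (𝓡 4) (𝓡 4) ∞ ψ) (hψo : IsOpenEmbedding ψ)
    (hψi : ∀ p : domain a M, @Eq (E4 →L[ℝ] E4 →L[ℝ] ℝ)
        (pullbackBilin (I := 𝓡 4) (I' := 𝓡 4) ψ 𝓢.metric.val p)
        (Kerr.bilin M a ((p : Kerr.region a M) : E4))) :
    ∃ Ψ : Kerr.exterior M a → 𝓢.carrier,
      ContMDiff 𝓘(ℝ, E4) (𝓡 4) ∞ Ψ ∧
      IsOpenEmbedding ((Kerr.lateRegion M a 0).restrict Ψ) ∧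
      ∀ τ : ℝ, 0 < τ → 𝓢.deviationCk (Kerr.background M a) Ψ k τ = 0 := by
  let Ψ : Kerr.exterior M a → 𝓢.carrier := ψ ∘ squashChart hM ha
  have hΨs : ContMDiff 𝓘(ℝ, E4) (𝓡 4) ∞ Ψ := hψs.comp (contMDiff_squashChart hM ha)
  -- the pulled-back metric is the Kerr metric on the late region
  have hpull : ∀ x : Kerr.exterior M a, 0 < (x : E4) 0 →
      @Eq (E4 →L[ℝ] E4 →L[ℝ] ℝ) (pullbackBilin (I := 𝓡 4) (I' := 𝓘(ℝ, E4)) Ψ 𝓢.metric.val x)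
        (Kerr.bilin M a x) := by
    intro x hx
    have hθ : MDifferentiableAt 𝓘(ℝ, E4) (𝓡 4) (squashChart hM ha) x :=
      (contMDiff_squashChart hM ha x).mdifferentiableAt (by simp)
    have hψ : MDifferentiableAt (𝓡 4) (𝓡 4) ψ (squashChart hM ha x) :=
      (hψs _).mdifferentiableAt (by simp)
    have hcomp : @Eq (E4 →L[ℝ] E4) (mfderiv 𝓘(ℝ, E4) (𝓡 4) Ψ x)
        (mfderiv (𝓡 4) (𝓡 4) ψ (squashChart hM ha x)) := by
      change @Eq (E4 →L[ℝ] E4) (mfderiv 𝓘(ℝ, E4) (𝓡 4) (ψ ∘ squashChart hM ha) x) _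
      rw [mfderiv_comp x hψ hθ, mfderiv_squashChart hM ha x hx]
      exact ContinuousLinearMap.ext fun v ↦ rfl
    have e1 : @Eq (E4 →L[ℝ] E4 →L[ℝ] ℝ)
        (pullbackBilin (I := 𝓡 4) (I' := 𝓘(ℝ, E4)) Ψ 𝓢.metric.val x)
        (pullbackBilin (I := 𝓡 4) (I' := 𝓡 4) ψ 𝓢.metric.val (squashChart hM ha x)) := by
      ext v w
      change 𝓢.metric.val (Ψ x) (mfderiv 𝓘(ℝ, E4) (𝓡 4) Ψ x v) (mfderiv 𝓘(ℝ, E4) (𝓡 4) Ψ x w) =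
        𝓢.metric.val (ψ (squashChart hM ha x)) (mfderiv (𝓡 4) (𝓡 4) ψ (squashChart hM ha x) v)
          (mfderiv (𝓡 4) (𝓡 4) ψ (squashChart hM ha x) w)
      rw [hcomp]
      rfl
    have e2 := hψi (squashChart hM ha x)
    rw [coe_coe_squashChart_of_nonneg hM ha x hx.le] at e2
    exact e1.trans e2
  have hdev : ∀ x : Kerr.exterior M a, 0 < (x : E4) 0 →
      𝓢.deviation (Kerr.background M a) Ψ x = 0 := by
    intro x hx
    change (show E4 →L[ℝ] E4 →L[ℝ] ℝ from
      pullbackBilin (I := 𝓡 4) (I' := 𝓘(ℝ, E4)) Ψ 𝓢.metric.val x) - Kerr.bilin M a x = 0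
    rw [hpull x hx]
    exact sub_self (Kerr.bilin M a x)
  -- the late region seen in `E4` is open, and the extended deviation vanishes on it with all derivatives
  have h0 : Continuous fun y : E4 ↦ y 0 := PiLp.continuous_apply 2 _ 0
  have hVopen : IsOpen {z : E4 | z ∈ Kerr.exterior M a ∧ 0 < z 0} :=
    (Kerr.exterior M a).2.inter (isOpen_lt continuous_const h0)
  have hext : ∀ z : E4, z ∈ Kerr.exterior M a → 0 < z 0 →
      ∀ m : ℕ, iteratedFDeriv ℝ m (𝓢.deviationExtend (Kerr.background M a) Ψ) z = 0 := by
    intro z hz hz0 m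
    have hloc : 𝓢.deviationExtend (Kerr.background M a) Ψ =ᶠ[𝓝 z] fun _ ↦ 0 := by
      filter_upwards [hVopen.mem_nhds ⟨hz, hz0⟩] with z' hz'
      exact (Spacetime.deviationExtend_coe 𝓢 (Kerr.background M a) Ψ ⟨z', hz'.1⟩).trans
        (hdev ⟨z', hz'.1⟩ hz'.2)
    rw [(Filter.EventuallyEq.iteratedFDeriv ℝ hloc m).eq_of_nhds, iteratedFDeriv_fun_zero]
    rfl
  refine ⟨Ψ, hΨs, hψo.comp (isOpenEmbedding_restrict_squashChart hM ha), fun τ hτ ↦ ?_⟩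
  -- the deviation vanishes identically near every point of the leaf `{t* = τ}`, `τ > 0`
  refine le_antisymm ?_ zero_le
  unfold Spacetime.deviationCk supCkENorm
  refine iSup₂_le fun m _ ↦ iSup₂_le fun z hz ↦ ?_
  obtain ⟨x, hxτ, rfl⟩ := hz
  have hx0 : (x : E4) 0 = τ := hxτ
  rw [hext (x : E4) x.2 (by rw [hx0]; exact hτ) m, enorm_zero]

/-- **The Kerr metric is recovered, in every `Cᵏ`, in every spacetime into which the Kerr slab embeds
isometrically**: under the hypotheses of `chart_of_slabEmbedding`, the region `Ψ '' {t* > 0}` of `𝓢`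
converges in `Cᵏ` to `g_{M,a}` (`Spacetime.ConvergesToKerr`; the deviation is eventually the constant `0`).
DHRT arXiv:2104.08222, §1. [cite: arXiv210408222, §1] -/
theorem convergesToKerr_of_slabEmbedding (hM : 0 < M) (ha : |a| < M) (k : ℕ) (𝓢 : Spacetime.{0} 4)
    (ψ : domain a M → 𝓢.carrier) (hψs : ContMDiff (𝓡 4) (𝓡 4) ∞ ψ) (hψo : IsOpenEmbedding ψ)
    (hψi : ∀ p : domain a M, @Eq (E4 →L[ℝ] E4 →L[ℝ] ℝ)
        (pullbackBilin (I := 𝓡 4) (I' := 𝓡 4) ψ 𝓢.metric.val p)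
        (Kerr.bilin M a ((p : Kerr.region a M) : E4))) :
    ∃ 𝒟oc : Set 𝓢.carrier, 𝓢.ConvergesToKerr 𝒟oc M a k := by
  obtain ⟨Ψ, hc, ho, hdev⟩ := chart_of_slabEmbedding hM ha k 𝓢 ψ hψs hψo hψi
  refine ⟨Ψ '' Kerr.lateRegion M a 0, convergesToKerr_image_of_lateChart 𝓢 M a k 0 Ψ hc ho ?_⟩
  refine tendsto_const_nhds.congr' ?_
  filter_upwards [eventually_gt_atTop 0] with τ hτ
  exact (hdev τ hτ).symm

variable [Kerr.Facts] [Kerr.SliceFacts]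

/-- **The Kerr slab itself converges to `g_{M,a}` in every `Cᵏ`** (identity embedding: the slab's metric is
the restricted Kerr metric, `(g|_U)_p = g_p` by `mfderiv_id`). DHRT arXiv:2104.08222, §1.
[cite: arXiv210408222, §1] -/
theorem convergesToKerr_slab (hM : 0 < M) (ha : |a| < M) (k : ℕ) :
    ∃ 𝒟oc : Set (development hM ha).carrier,
      (development hM ha).toSpacetime.ConvergesToKerr 𝒟oc M a k := by
  refine convergesToKerr_of_slabEmbedding hM ha k (development hM ha).toSpacetime id contMDiff_id
    IsOpenEmbedding.id fun p ↦ ?_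
  exact (congrFun (pullbackBilin_id (I := 𝓡 4) (M := (development hM ha).carrier)
    (development hM ha).metric.val) p).trans rfl

end Chart

/-! ## §2 The existential form of the crux at the centre, and the conclusion for every MGHD -/

section Centre

variable [Kerr.Facts] [Kerr.SliceFacts]

/-- **One good development of the exact Kerr datum.**  For `0 < M`, `|a| < M` and every order `k`, the
exact Kerr–Schild slice datum `Kerr.data M a M` HAS a vacuum Cauchy development which is far-complete
(far-origin completeness of `𝓘⁺` in Christodoulou's sojourn form, `DataEmbedding.HasCompleteFutureNullInfinityFar`)
and has a region converging in `Cᵏ` to `g_{M,a}`: the Kerr slab `KerrSlab.development hM ha`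
(`farComplete_kerrSlab`, `convergesToKerr_slab`).  This is the hypothesis of
`CaptureAscent.bulkKerrCaptureC2_of_forall_exists` — the printed shape of the stability theorems the crux
imports — discharged at the centre of the data ball (perturbation `0`), with `(M', a') = (M, a)`.
Dafermos–Rodnianski arXiv:0811.0354, §5.1; Christodoulou, CQG 16 (1999), pp. A26–A27.
[cite: arXiv08110354, §5.1] -/
theorem exists_goodDevelopment_centre (hM : 0 < M) (ha : |a| < M) (k : ℕ) :
    ∃ (𝒟₀ : VacuumCauchyDevelopment (Kerr.data M a M hM.le)) (𝒟oc : Set 𝒟₀.carrier),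
      𝒟₀.HasCompleteFutureNullInfinityFar ∧ 𝒟₀.toSpacetime.ConvergesToKerr 𝒟oc M a k := by
  obtain ⟨𝒟oc, hconv⟩ := convergesToKerr_slab hM ha k
  exact ⟨development hM ha, 𝒟oc,
    (farComplete_iff_hasCompleteFutureNullInfinityFar _).1 (farComplete_kerrSlab hM ha), hconv⟩

/-- **The conclusion of the crux at the centre, parameters pinned, every order.**  For `0 < M`, `|a| < M`,
every `k` and every MAXIMAL vacuum Cauchy development `𝒟` of the exact Kerr datum `Kerr.data M a M`: `𝒟` is
far-complete and some region of `𝒟` converges in `Cᵏ` to `g_{M,a}` — maximality embeds the good development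
of `exists_goodDevelopment_centre` into `𝒟` (`VacuumCauchyDevelopment.IsMaximal`, Ringström 2009, Def. 16.5)
and both properties ascend along the embedding (`CaptureAscent`).  Choquet-Bruhat–Geroch, CMP 14 (1969),
Thm. 3. [cite: Ringstrom2009, Def. 16.5] -/
theorem conclusion_centre (hM : 0 < M) (ha : |a| < M) (k : ℕ)
    (𝒟 : VacuumCauchyDevelopment (Kerr.data M a M hM.le)) (hmax : 𝒟.IsMaximal) :
    𝒟.HasCompleteFutureNullInfinityFar ∧
      ∃ 𝒟oc : Set 𝒟.carrier, 𝒟.toSpacetime.ConvergesToKerr 𝒟oc M a k := by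
  obtain ⟨𝒟₀, 𝒟oc₀, hfar, hconv⟩ := exists_goodDevelopment_centre hM ha k
  have hemb : 𝒟₀.toCauchyDevelopment.EmbedsInto 𝒟.toCauchyDevelopment := hmax 𝒟₀
  exact ⟨hasCompleteFutureNullInfinityFar_of_embedsInto hemb hfar, convergesToKerr_of_embedsInto hemb hconv⟩

/-- **The matrix of the crux at its centre datum.**  For every exponent vector `(s, δ)`, basin `ε`,
tolerance `η ≥ 0`, `0 < M` and `|a| < M`, the body of `CaptureC2At s δ M _ ε η a` holds at
`D = Kerr.data M a M` (which lies in the ball whenever `ε > 0`): every MGHD of the exact datum is far-complete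
and has a region converging in `C²` to the sub-extremal `g_{M,a}` itself, `|M − M| + |a − a| = 0 ≤ η`.
[cite: Ringstrom2009, Def. 16.5] -/
theorem captureC2At_centre (hM : 0 < M) (ha : |a| < M) {η : ℝ} (hη : 0 ≤ η)
    (𝒟 : VacuumCauchyDevelopment (Kerr.data M a M hM.le)) (hmax : 𝒟.IsMaximal) :
    ∃ (M' a' : ℝ) (𝒟oc : Set 𝒟.carrier), Kerr.IsSubextremal M' a' ∧
      𝒟.HasCompleteFutureNullInfinityFar ∧
      𝒟.toSpacetime.ConvergesToKerr 𝒟oc M' a' 2 ∧ |M' - M| + |a' - a| ≤ η := by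
  obtain ⟨hfar, 𝒟oc, hconv⟩ := conclusion_centre hM ha 2 𝒟 hmax
  exact ⟨M, a, 𝒟oc, ha, hfar, hconv, by simpa using hη⟩

/-- **`Negative.bulkKerrCaptureC2_atKerrData` without its hypotheses.**  For every `M > 0` and every
sub-extremal spin, every MGHD of the exact Kerr datum on `{t* = 0, r > M}` is far-complete and, for EVERY
tolerance `η > 0`, has a region converging in `C²` to some sub-extremal `g_{M',a'}` with
`|M' − M| + |a' − a| ≤ η` — the consequent of `Negative.bulkKerrCaptureC2_atKerrData` with neither
`h : BulkKerrCaptureC2` nor the constraint hypothesis `hvac` (the witness is `(M, a)` at every `η`).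
[cite: Ringstrom2009, Def. 16.5] -/
theorem atKerrData_holds (hM : 0 < M) (ha : Kerr.IsSubextremal M a)
    (𝒟 : VacuumCauchyDevelopment (Kerr.data M a M hM.le)) (hmax : 𝒟.IsMaximal) :
    𝒟.HasCompleteFutureNullInfinityFar ∧
      ∀ η > (0 : ℝ), ∃ (M' a' : ℝ) (𝒟oc : Set 𝒟.carrier), Kerr.IsSubextremal M' a' ∧
        𝒟.toSpacetime.ConvergesToKerr 𝒟oc M' a' 2 ∧ |M' - M| + |a' - a| ≤ η := by
  have ha' : |a| < M := ha
  obtain ⟨hfar, 𝒟oc, hconv⟩ := conclusion_centre hM ha' 2 𝒟 hmax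
  exact ⟨hfar, fun η hη ↦ ⟨M, a, 𝒟oc, ha, hconv, by simpa using hη.le⟩⟩

/-- **`Negative.bulkKerrCaptureC2_atSchwarzschildData` without its hypothesis `h : BulkKerrCaptureC2`.**
For every `M > 0`, every MGHD of the Schwarzschild datum on `{t* = 0, r > M}` is far-complete and, for
every `η > 0`, converges in `C²` on some region to some sub-extremal `g_{M',a'}` with `|M' − M| + |a'| ≤ η`
(witness `(M, 0)`). [cite: Ringstrom2009, Def. 16.5] -/
theorem atSchwarzschildData_holds (hM : 0 < M)
    (𝒟 : VacuumCauchyDevelopment (Kerr.data M 0 M hM.le)) (hmax : 𝒟.IsMaximal) :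
    𝒟.HasCompleteFutureNullInfinityFar ∧
      ∀ η > (0 : ℝ), ∃ (M' a' : ℝ) (𝒟oc : Set 𝒟.carrier), Kerr.IsSubextremal M' a' ∧
        𝒟.toSpacetime.ConvergesToKerr 𝒟oc M' a' 2 ∧ |M' - M| + |a' - 0| ≤ η :=
  atKerrData_holds hM (show |(0 : ℝ)| < M by simpa using hM) 𝒟 hmax

/-- **A refutation of the crux must leave the centre.**  If, for some exponent vector, basin and tolerance
`η ≥ 0`, a b-conormal vacuum datum `D` on `Kerr.slice a M` (`0 < M`, `|a| < M`) in the ball has a maximal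
vacuum Cauchy development violating the conclusion of `CaptureC2At`, then `D ≠ Kerr.data M a M`: the bad
datum of any counterexample (`Negative.LoadBearing`) is a genuine perturbation of the Kerr data.
[cite: Ringstrom2009, Def. 16.5] -/
theorem ne_centre_of_not_conclusion (hM : 0 < M) (ha : |a| < M) {η : ℝ} (hη : 0 ≤ η)
    {D : InitialDataSet 𝓘(ℝ, E3) (Kerr.slice a M)} (𝒟 : VacuumCauchyDevelopment D) (hmax : 𝒟.IsMaximal)
    (hbad : ¬ ∃ (M' a' : ℝ) (𝒟oc : Set 𝒟.carrier), Kerr.IsSubextremal M' a' ∧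
      𝒟.HasCompleteFutureNullInfinityFar ∧
      𝒟.toSpacetime.ConvergesToKerr 𝒟oc M' a' 2 ∧ |M' - M| + |a' - a| ≤ η) :
    D ≠ Kerr.data M a M hM.le := by
  rintro rfl
  exact hbad (captureC2At_centre hM ha hη 𝒟 hmax)

end Centre

/-- **Registered sub-goal `stub_captureC2At_centre`** (crux item stmt-FinalStateConjecture-14985): the matrix
`CaptureC2At` of the crux at its centre datum `D := Kerr.data M a M` — every MGHD of the exact sub-extremal
Kerr datum is far-complete and has a region converging in `C²` to a sub-extremal `g_{M',a'}` with
`|M' − M| + |a' − a| ≤ η`, for every `η ≥ 0` (closed form of `captureC2At_centre`, witness `(M, a)`).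
[cite: Ringstrom2009, Def. 16.5] -/
theorem stub_captureC2At_centre : ∀ [Kerr.Facts] [Kerr.SliceFacts] (M : ℝ) (hM : 0 < M) (a : ℝ), |a| < M → ∀ η : ℝ, 0 ≤ η → ∀ 𝒟 : VacuumCauchyDevelopment (Kerr.data M a M hM.le), 𝒟.IsMaximal → ∃ (M' a' : ℝ) (𝒟oc : Set 𝒟.carrier), Kerr.IsSubextremal M' a' ∧ 𝒟.HasCompleteFutureNullInfinityFar ∧ 𝒟.toSpacetime.ConvergesToKerr 𝒟oc M' a' 2 ∧ |M' - M| + |a' - a| ≤ η :=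
  fun _ hM _ ha _ hη 𝒟 hmax ↦ captureC2At_centre hM ha hη 𝒟 hmax

end Summit.FinalStateConjecture.FinalStateConjecture.Theorems.BulkKerrCaptureC2.Centre

end
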